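/- Copyright: the b2b-balaban cell (near-miss cell 7), T⁴-continuum fan-out, lineage t4-ne7b-p1 (row NE7b OWNER + CRUX
PROVER NE7b), gen 45: (α)-M5-3d «THE PRICE PLUG» — M2 brick B's term weight in the END's price currency.  Released under
the licence of the surrounding project. -/
import Summits.QuantumFields.BalabanUV.T4Continuum.Support.B16HistoryWeightPlug
import Summits.QuantumFields.BalabanUV.T4Continuum.Support.HistoryBankingCreditPlug

/-!
# M2 brick B × M5-2 × M5-3: THE WEIGHT OF A (1.72) TERM IN THE END's PRICE CURRENCY — `weight ≤ PRICE · DEAD · rest`,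
`PRICE = ∏_{live} pshapeTH … (costT) · e^{birthWT (uV K)} · e^{−Ξ K}` (re-open object (α) of row NE7b, `SCOPE-alpha.md` §5
rows M2∕M5; ruling R-OWNER-45-1, owner gen 45)

Summits-side support leaf of the T⁴-continuum cell (rung (B)+1 on a FINITE torus only; NOT infinite volume, NOT the
mass gap, NOT the Clay statement; NOT a proof of the spine estimate NE7b — the cell's OWN estimate, NOT PRINTED, NOT
PROVED).  [folklore] composition BY NAME of leaf-04's M2 brick B as plugged by M5-2 (`B16HistoryWeightPlug.weight_le_live_mul_dead`:
`weight ≤ LIVE · DEAD · rest`) with the owner's M5-3c (`HistoryBankingCreditPlug.prod_liveFactor_pedMV_le`: `LIVE ≤ PRICE`);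
no definition, no `[cite:]` tag, nothing printed asserted, no `Prop` fact minted, zero `sorry`.

WHAT.  **`weight_le_price_mul_dead`**: under the displayed identification `HistRead` (M2-B), the displayed factor readings
`FactorRead (fB K) (fR K) (sB K) (sR K)` and rounding-with-room junction `RoundingRoom C O L K R (g K) (sB K) (sR K)` (M5-3),
the pass-V process conditions of the run read off the term, the banking side conditions, (2.9) on the run's sizes and the
calibrated volume displays for the per-cube costs `Λ K` (M5-2), for `K₀ ≤ K`, `|t| ≤ l₀`, `(h, ℓ, c) ∈ LIdx a`:
`weight μ Rp t ⟨K, a, (h, ℓ, c)⟩ ≤ PRICE · DEAD · rest`, where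
`PRICE = ∏_{x ∈ histV.comp K} pshapeTH Prod.fst O C 1 1 J.R (g K) 0 (costT Prod.fst C K J.R) (pedMV.genT (K, x)) ·
e^{birthWT Prod.fst (2^{d+3}·log Λ K) (pedMV.genT (K, x))} · e^{−(8∕E₂·totalCostT … (pedMV.genT (K, x)) + 4·partnerAges … (pedMV.genT (K, x)))}`
is — member by member — the right-hand side of the `κ := costT` price sentence `priceM` of `HistoryRealiseCellsRunApexT3bWTVS`
(class remainder weight `uV K = 2^{d+3}·log Λ K`), `DEAD` the dead genealogies' tree volumes and event products (to
`dead`∕`resumM`), `rest` the envelope (to `nup`).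

HONEST SCOPE.  Bookkeeping; every display is a HYPOTHESIS (R-class): `HistRead` (the identification), `FactorRead` ∕
`RoundingRoom` (the credit reading), the calibrated volume displays; nothing of H3 ∕ (B) ∕ BetaPertH discharged; the
END-side identification of `histV.comp K` with the `memOf` members and the witness fields `FcM := PRICE-side live product`,
`dead`, `nup` are the S12-W crew's (INTERFACE REQUEST IR-45-1).  BY-NAME EFFECT ON THE WALL: with this file the owner's side
of `priceM` at `κ := costT` is COMPLETE modulo displays — what the END's `priceM` asks of a (1.72) term's live part is
supplied by M2-B's factor data read event-wise; `resumM` (dead part) and `reprA∕reprB`∕`realised` unchanged (WALL-NE7b-P1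
v1.19).  NE7b NOT proved; spine 0∕9.  HONEST DEPENDENCY (cell): continuum YM on T⁴ ⇐ BetaPertH ∧ nine spine estimates
(0/9 proved); BetaPertH ⇐ (D1) ∧ (D4) ∧ CAP+tail; G-an2-4 gates asym, D1 and NE2/3/4.  This file changes none of it.
-/

open Finset MeasureTheory
open Literature.MathematicalPhysics.QuantumFieldTheory.Balaban1983to89
open Literature.MathematicalPhysics.QuantumFieldTheory.Balaban1983to89.B13ScaleTransfer
open Literature.MathematicalPhysics.QuantumFieldTheory.Balaban1983to89.B16SProfile
open T4PersistenceDictionary T4PrintedShapeBanking T4TaggedShapeBanking T4BankedInduction T4PartnerMultiplicity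
open Summit.QuantumFields.BalabanUV.T4Continuum.HistoryAdmissible
open Summit.QuantumFields.BalabanUV.T4Continuum.HistoryGen
open Summit.QuantumFields.BalabanUV.T4Continuum.HistoryGenealogyExtraction
open Summit.QuantumFields.BalabanUV.T4Continuum.HistoryGenealogyRealise
open Summit.QuantumFields.BalabanUV.T4Continuum.HistoryGenealogyInstantiate
open Summit.QuantumFields.BalabanUV.T4Continuum.HistoryGenealogyPedigree
open Summit.QuantumFields.BalabanUV.T4Continuum.B16HistoryIndexedRepr
open Summit.QuantumFields.BalabanUV.T4Continuum.HistoryBankingLE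
open Summit.QuantumFields.BalabanUV.T4Continuum.HistoryConstants
open Summit.QuantumFields.BalabanUV.T4Continuum.HistoryBankingForestVolume
open Summit.QuantumFields.BalabanUV.T4Continuum.HistoryBankingVolumePlug
open Summit.QuantumFields.BalabanUV.T4Continuum.HistoryBankingForestPlug
open Summit.QuantumFields.BalabanUV.T4Continuum.HistoryBankingDiscountCharge
open Summit.QuantumFields.BalabanUV.T4Continuum.HistoryBankingCreditRead
open Summit.QuantumFields.BalabanUV.T4Continuum.HistoryBankingCreditPlug
open Summit.QuantumFields.BalabanUV.T4Continuum.B16HistoryWeightPlug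

namespace Summit.QuantumFields.BalabanUV.T4Continuum.B16HistoryPricePlug

noncomputable section

-- the structural `DecidableEq` instance of the concrete tag type exceeds the default synthesis size (as in the
-- siblings `B16HistoryWeightPlug` ∕ `HistoryBankingForestPlug`)
set_option synthInstance.maxSize 1024

variable {DomK : ℕ → Type*} {I : (K : ℕ) → HIndex (DomK K)} {d : ℕ} {X : ℕ → Type*}
  {𝒢 : (K : ℕ) → GoodClass (X K)}

/-- **THE WEIGHT OF A (1.72) TERM IN THE END's PRICE CURRENCY**: `weight ≤ PRICE · DEAD · rest` (M2 brick B × M5-2 × M5-3;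
all hypotheses of `B16HistoryWeightPlug.weight_le_live_mul_dead` VERBATIM, plus the credit reading's displays
`FactorRead` ∕ `RoundingRoom` for the run `K`, (2.9) on its sizes with `1 ≤ L`, and `0 < E₂`). [folklore] -/
theorem weight_le_price_mul_dead [∀ K, MeasurableSpace (X K)] (ℛ : HistReading I d) (Φf : HistFactors I d)
    (μ : (K : ℕ) → Measure (X K)) [∀ K, IsFiniteMeasure (μ K)] (Rp : (K : ℕ) → ℝ → Repr172R (𝒢 K) (I K))
    {l₀ : ℝ} {K₀ : ℕ} (hR : HistRead ℛ Φf Rp l₀ K₀) {K : ℕ} (hK : K₀ ≤ K) {t : ℝ} (ht : |t| ≤ l₀)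
    (a : (I K).Adm) {h : (I K).HZ} {l : (I K).HL} {c : (I K).HC} (hι : (h, l, c) ∈ (I K).LIdx a)
    (hN : (ℛ.runOf K a (h, l, c)).NewOK)
    (hRm : ∀ t k, (ℛ.runOf K a (h, l, c)).Rm t k ≤ (ℛ.runOf K a (h, l, c)).R t)
    (hRmS : ∀ t k, (ℛ.runOf K a (h, l, c)).Rm t (k + 1) ≤ (ℛ.runOf K a (h, l, c)).R (t + 1))
    (hRm2 : ∀ t, 2 ≤ (ℛ.runOf K a (h, l, c)).Rm t 1) (hD : (ℛ.runOf K a (h, l, c)).NewDisjoint)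
    (hL0 : 0 < (ℛ.runOf K a (h, l, c)).L) (hL4 : 4 ≤ (ℛ.runOf K a (h, l, c)).L)
    (hdrop : ∀ m, DropCtl (ℛ.runOf K a (h, l, c)).s m) (hR1 : ∀ t, 1 ≤ (ℛ.runOf K a (h, l, c)).R t)
    {C : T4PrintedShapeBanking.Consts} (hn₁ : 13 ≤ C.n₁) (hE₂ : 0 < C.E₂) (hE₃ : 0 ≤ C.E₃) {Lu : ℝ} (hLu0 : 0 < Lu)
    {j : ℕ} (hj1 : 1 ≤ j) (hLu : ∀ t i, i ≤ j → Real.log (Φf.Λ K (t + i)) ≤ Lu * Real.log (Φf.Λ K t))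
    (hsmall : (1122 : ℝ) ^ d * 16 * 21 ^ d * Lu ≤ 2 ^ j / 2)
    (huΦ : ∀ t, t ≤ K →
      Real.log (Φf.Λ K t) * (6 * (561 ^ d * j * Lu + 1122 ^ d * Lu)) ≤ floorK C K (ℛ.runOf K a (h, l, c)).R t)
    (huE₂ : ∀ n, n ≤ K → Real.log (Φf.Λ K n) * (15 * 126 ^ d) ≤ C.E₂ * ((ℛ.runOf K a (h, l, c)).R n : ℝ) ^ C.q')
    (huE₃ : ∀ n, n ≤ K → Real.log (Φf.Λ K n) * (24 * 126 ^ d) ≤ C.E₃ * ((ℛ.runOf K a (h, l, c)).R n : ℝ) ^ C.q')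
    {O : PrintedO1s} {g : ℕ → ℝ} {L : ℕ} {β' β₀ : ℝ} {sB : ℕ → ℕ → ℝ} {sR : ℕ → ℝ}
    (hF : FactorRead (Φf.fB K) (Φf.fR K) sB sR) (hRR : RoundingRoom C O L K (ℛ.runOf K a (h, l, c)).R g sB sR)
    (h29 : B14FlowStep.FlowIneq29 (ℛ.runOf K a (h, l, c)).R g L β' β₀ K) (hL1 : 1 ≤ L) :
    Repr172R.weight μ Rp t ⟨K, a, (h, l, c)⟩ ≤
      (∏ x ∈ (ℛ.runOf K a (h, l, c)).histV.comp K,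
          pshapeTH Prod.fst O C 1 1 (ℛ.runOf K a (h, l, c)).R g 0 (costT Prod.fst C K (ℛ.runOf K a (h, l, c)).R)
              ((ℛ.runOf K a (h, l, c)).pedMV.genT (K, x)) *
            Real.exp (birthWT Prod.fst (fun n => 2 ^ (d + 3) * Real.log (Φf.Λ K n))
              ((ℛ.runOf K a (h, l, c)).pedMV.genT (K, x))) *
            Real.exp (-(8 / C.E₂ * totalCostT Prod.fst C K (ℛ.runOf K a (h, l, c)).R
                ((ℛ.runOf K a (h, l, c)).pedMV.genT (K, x)) +
              4 * (partnerAges (PEv.step ∘ Prod.fst) ((ℛ.runOf K a (h, l, c)).pedMV.genT (K, x)) : ℝ)))) *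
        (∏ j ∈ Finset.range K, ∏ x ∈ (ℛ.runOf K a (h, l, c)).histV.died j,
          Real.exp (treeVol (ℛ.runOf K a (h, l, c)).L (ℛ.runOf K a (h, l, c)).s (fun v => (v : ℝ))
              (ℛ.runOf K a (h, l, c)).pedMV (fun j => Real.log (Φf.Λ K j)) j (j, x)) *
            evProd (Φf.fB K) (Φf.fR K) ((ℛ.runOf K a (h, l, c)).pedMV.toPGen id (j, x))) *
        (Real.exp (Φf.BA K t) * (Φf.wC K t a c * Real.exp (Φf.BV K t a h l c)) * (μ K).real Set.univ) := by
  set J := ℛ.runOf K a (h, l, c) with hJ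
  have hw := weight_le_live_mul_dead ℛ Φf μ Rp hR hK ht a hι hN hRm hRmS hRm2 hD hL0 hL4 hdrop hR1 hn₁ hE₂.le hE₃ hLu0
    hj1 hLu hsmall huΦ huE₂ huE₃
  have hlive := prod_liveFactor_pedMV_le (I := J) (O := O) hN hRm hRmS hRm2 hD hL0 hL4 hdrop hR1 hn₁ hE₂ hE₃ hF hRR
    h29 hL1 (fun n => 2 ^ (d + 3) * Real.log (Φf.Λ K n))
  -- the dead part and the envelope are nonnegative
  have hdead : 0 ≤ ∏ j ∈ Finset.range K, ∏ x ∈ J.histV.died j,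
      Real.exp (treeVol J.L J.s (fun v => (v : ℝ)) J.pedMV (fun j => Real.log (Φf.Λ K j)) j (j, x)) *
        evProd (Φf.fB K) (Φf.fR K) (J.pedMV.toPGen id (j, x)) :=
    Finset.prod_nonneg fun j _ => Finset.prod_nonneg fun x _ =>
      mul_nonneg (Real.exp_pos _).le (evProd_nonneg hF.fB_nonneg hF.fR_nonneg _)
  have hmem : h ∈ (I K).HZs a ∧ l ∈ (I K).HYs a ∧ c ∈ (I K).HCs a := by
    simpa [HIndex.LIdx, Finset.mem_product] using hι
  -- the envelope is nonnegative: `wC ≥ 0` when the fibre is inhabited, the mass vanishes when it is empty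
  have hE : 0 ≤ Real.exp (Φf.BA K t) * (Φf.wC K t a c * Real.exp (Φf.BV K t a h l c)) * (μ K).real Set.univ := by
    rcases isEmpty_or_nonempty (X K) with hX | ⟨⟨x⟩⟩
    · have h0 : (μ K).real Set.univ = 0 := by
        rw [Set.univ_eq_empty_iff.mpr hX, measureReal_empty]
      rw [h0, mul_zero]
    · have hwC : 0 ≤ Φf.wC K t a c :=
        (((Rp K t).TC a c).one_nonneg x).trans (hR.tc_le K t ht hK a c hmem.2.2 x)
      exact mul_nonneg (mul_nonneg (Real.exp_pos _).le (mul_nonneg hwC (Real.exp_pos _).le)) measureReal_nonneg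
  exact hw.trans (mul_le_mul_of_nonneg_right (mul_le_mul_of_nonneg_right hlive hdead) hE)

end

end Summit.QuantumFields.BalabanUV.T4Continuum.B16HistoryPricePlug
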